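import Mathlib
import HarnessLib
import Summits.AtomisticToContinuum.FouriersLaw.Theses.JunctionLocality
import Summits.AtomisticToContinuum.FouriersLaw.Theorems.JunctionLocalitySuperadditiveResistanceStubTerminationLocalityAux6
import Summits.AtomisticToContinuum.FouriersLaw.Theorems.JunctionLocalitySuperadditiveResistanceStubTerminationLocalityTCPower

/-!
# Termination locality in the κ-frame, helper VII: the junction power pairing of a resolvent family, EXACTLY
(stub `stub_terminationLocality` (S1') of line `floating-probe-bypass-laplacian`, skeleton v7, crux
`JunctionLocality.SuperadditiveResistance`, stmt-AtomisticToContinuum-11748)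

Helpers V/VI (`…Aux5/6`) proved `K₀₀(κ) − G_N = −(γ²/T²)(S_N + Dyn_N(κ)) + (γ²/T²) κ X_N(κ)` and reduced the registered
stub to ONE `N`-uniform inequality on `S_N + Dyn_N`. The `p_{N−1}`-LINEAR (Rayleigh) part of
`Dyn_N = ⟨g_0∘R, V'(r_J)(∂_{p_{N−1}} g_N)∘π_N⟩` is `(G_N/γ²)·JP_N` with the JUNCTION POWER PAIRING
`JP_N = ⟨g_0∘R, V'(q_N − q_{N−1}) p_{N−1}⟩_{μ_T^{(N+M)}}`. This file evaluates `JP_N` EXACTLY, at FIXED `N, M, κ`, in the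
skeleton's own `κ`-resolvent Kubo coordinates:

* `junctionPowerPairing_resolvent_density`, `junctionPowerPairing_resolvent` — for a classical `κ`-resolvent field `g_0`
  of bath `0`: `JP_N = γ(⟨g_0, p_0² − T⟩ + ⟨g_0, p²_{N−1} − T⟩) − T² + κ ⟨g_0∘R, H_N∘π_N⟩` (cross Green identity
  `Kubo.cross` of the left-block energy `H_N∘π_N`, whose device source is the two left thermostat powers plus the junction
  power — landed `leftEnergy_pair` — against the BACKWARD resolvent pair `(g_0∘R, p_0² − T − κ g_0∘R)`, and
  `⟨H_N∘π_N, p_0² − T⟩ = T²` by Gaussian integration by parts);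
* `junctionPowerPairing_eq_kubo` — in Kubo coordinates `JP_N = −(T²/γ)(K₀₀ + K₀₁) + κ ⟨g_0∘R, H_N∘π_N⟩`;
* `kuboMatrix_rowsum_zero` — the `κ`-mass row sum `K₀₀ + K₀₁ + K₀₂ + K₀₃ = (γκ/T²)⟨g_0, H⟩` (`Kubo.resolvent_sum_kuboPair`);
* `helper_terminationJunctionPowerResolvent` (registered) — hence
  `JP_N = (T²/γ)(K₀₂ + K₀₃) − κ ⟨g_0∘R, H − H_N∘π_N⟩` for every resolvent family (`N, M ≥ 2`, any `κ`).

SIGN. `−(γ²/T²)·(G_N/γ²)·JP_N = (G_N/γ)(K₀₀ + K₀₁) = −(G_N/γ)(K₀₂ + K₀₃)` up to `κ`-terms, which is `≥ 0` whenever the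
transfers from bath `0` to the terminals BEYOND the probe are non-negative (`K₀₂, K₀₃ ≤ 0`): the Rayleigh part is NOT a
gain but the physical excess `K₀₀ − G_N ≈ (G_N/γ)·(conductance past the probe)` (renewal at the bathed site), of the
very size `G_N K₀₀` of the stub's right-hand side. What has to be SMALL `N`-uniformly is the rest, `S_N + Dyn_N^{fl}`
(end-site deviations from local equilibrium): helper VIII (`…Aux8`) reduces the registered stub to exactly that, helper
IX (`…Aux9`) lands `N`-uniform a priori budgets. Fixed-`N` statements, standard axioms, no named fact used.
-/

noncomputable section

open MeasureTheory Filter Topology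
open scoped ContDiff
open Literature.MathematicalPhysics.KineticTheory.HeatConduction
open Summit.AtomisticToContinuum.FouriersLaw.Theorems.SuperadditiveResistance.DeviceLiouville
  (kin deviceGenerator deviceWeight deviceGenerator_eq kin_eq_sq liouvilleOp bathOp)
open Summit.AtomisticToContinuum.FouriersLaw.Theorems.SuperadditiveResistance.Kubo
  (rev rev_apply contDiff_rev memLp_rev cross memLp_kinetic memLp_momentum memLp_hamiltonian gauss_ibp partition_pos
    integrable_mul_mul_gibbsDensity integral_sq_mul_gibbsDensity_eq integral_rev_mul_gibbsDensity termWeight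
    resolvent_sum_kuboPair)
open Summit.AtomisticToContinuum.FouriersLaw.Theorems.SuperadditiveResistance.TerminationLocality
  (restrictLeft contDiff_comp_restrictLeft memLp_comp_restrictLeft)
open Summit.AtomisticToContinuum.FouriersLaw.Cruxes.SuperadditiveResistance.ThermaliseThenCutProbeInsertion
  (memLp_junctionForce_mul_comp_restrictLeft leftEnergy_pair partialP_comp_restrictLeft_castAdd)

namespace Summit.AtomisticToContinuum.FouriersLaw.Cruxes.SuperadditiveResistance.FloatingProbeBypassLaplacian

/-! ## The junction power pairing of a resolvent field (fixed `N`, `M`, `κ`; exact) -/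

section JunctionPower

variable {ω₂ lam β γ T : ℝ} {N M : ℕ}

/-- `V'(r_J) · p_{N−1} ∈ L²(μ_T^{(N+M)})`. -/
theorem memLp_junctionForce_mul_momentum (hω : 0 < ω₂) (hl : 0 ≤ lam) (hβ : 0 ≤ β) (γ : ℝ) (hN : 1 ≤ N)
    (hM : 1 ≤ M) (hT : 0 < T) :
    MemLp (fun x : PhaseSpace (N + M) => junctionForce β hN hM x * x.2 ⟨N - 1, by omega⟩) 2
      ((pinnedChain ω₂ lam β γ).gibbsMeasure (N + M) T) :=
  memLp_junctionForce_mul_comp_restrictLeft hω hl hβ γ hN hM hT (Φ := fun y : PhaseSpace N => y.2 ⟨N - 1, by omega⟩)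
    (by fun_prop) (memLp_momentum hω hl hβ N hT ⟨N - 1, by omega⟩)

/-- **The junction power pairing of a `κ`-resolvent field, density form.** For a classical `κ`-resolvent field
`g_0 ∈ C² ∩ L²(μ_T^{(N+M)})` of bath `0` (`κ g_0 − L_dev g_0 = p_0² − T`):
`γ(∫ g_0 (p_0² − T) ρ + ∫ g_0 (p²_{N−1} − T) ρ) − ∫ (g_0∘R) V'(r_J) p_{N−1} ρ = T² ∫ ρ − κ ∫ (g_0∘R) (H_N∘π_N) ρ`
(`ρ = e^{−H/T}`): the cross Green identity for the pair `H_N∘π_N` (`leftEnergy_pair`) against the BACKWARD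
resolvent pair `(g_0∘R, (p_0² − T) − κ g_0∘R)`, and `∫ (H_N∘π_N)(p_0² − T) ρ = T² ∫ ρ`. -/
theorem junctionPowerPairing_resolvent_density (hω : 0 < ω₂) (hl : 0 ≤ lam) (hβ : 0 ≤ β) (hγ : 0 < γ)
    (hN : 1 ≤ N) (hM : 1 ≤ M) (hT : 0 < T) (κ : ℝ) {g₀ : PhaseSpace (N + M) → ℝ} (hg₀C : ContDiff ℝ 2 g₀)
    (hg₀L : MemLp g₀ 2 ((pinnedChain ω₂ lam β γ).gibbsMeasure (N + M) T))
    (hpde₀ : ∀ x, κ * g₀ x - deviceGenerator (pinnedChain ω₂ lam β γ) N M (fun _ => T) g₀ x =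
      kin (N + M) 0 x - T) :
    γ * ((∫ x, g₀ x * (x.2 ⟨0, by omega⟩ ^ 2 - T) * (pinnedChain ω₂ lam β γ).gibbsDensity (N + M) T x) +
          ∫ x, g₀ x * (x.2 ⟨N - 1, by omega⟩ ^ 2 - T) * (pinnedChain ω₂ lam β γ).gibbsDensity (N + M) T x) -
        ∫ x, rev g₀ x * (junctionForce β hN hM x * x.2 ⟨N - 1, by omega⟩) *
          (pinnedChain ω₂ lam β γ).gibbsDensity (N + M) T x =
      T ^ 2 * (∫ x, (pinnedChain ω₂ lam β γ).gibbsDensity (N + M) T x) -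
        κ * ∫ x, rev g₀ x * ((pinnedChain ω₂ lam β γ).hamiltonian N (x.1 ∘ Fin.castAdd M, x.2 ∘ Fin.castAdd M)) *
          (pinnedChain ω₂ lam β γ).gibbsDensity (N + M) T x := by
  set P := pinnedChain ω₂ lam β γ with hP
  set ρ := P.gibbsDensity (N + M) T with hρ
  -- the forward pair `(H_N ∘ π_N, kf)`
  set f : PhaseSpace (N + M) → ℝ := P.hamiltonian N ∘ restrictLeft N M with hf
  set kf : PhaseSpace (N + M) → ℝ := fun x =>
    γ * ((x.2 ⟨0, by omega⟩ ^ 2 - T) + (x.2 ⟨N - 1, by omega⟩ ^ 2 - T)) -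
      junctionForce β hN hM x * x.2 ⟨N - 1, by omega⟩ with hkf
  have hpair_f : ∀ x, 1 * liouvilleOp P (N + M) f x + γ * bathOp (N + M) (deviceWeight N M) T f x = -kf x := by
    intro x
    rw [leftEnergy_pair γ T hN hM x]
    simp only [hkf, junctionForce]
  have hHs : ContDiff ℝ 2 (P.hamiltonian N) :=
    (P.contDiff_hamiltonian (pinnedChain_contDiff_U ω₂ lam β γ) (pinnedChain_contDiff_V ω₂ lam β γ) N).of_le
      (by norm_cast)
  have hfC : ContDiff ℝ 2 f := contDiff_comp_restrictLeft hHs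
  have hfL2 : MemLp f 2 (P.gibbsMeasure (N + M) T) :=
    memLp_comp_restrictLeft hω hl hβ γ hN hM hT (memLp_hamiltonian hω hl hβ N hT)
  have hk0' : MemLp (fun x : PhaseSpace (N + M) => x.2 ⟨0, by omega⟩ ^ 2 - T) 2 (P.gibbsMeasure (N + M) T) :=
    memLp_kinetic (γ := γ) hω hl hβ (N + M) hT ⟨0, by omega⟩
  have hk1' : MemLp (fun x : PhaseSpace (N + M) => x.2 ⟨N - 1, by omega⟩ ^ 2 - T) 2 (P.gibbsMeasure (N + M) T) :=
    memLp_kinetic (γ := γ) hω hl hβ (N + M) hT ⟨N - 1, by omega⟩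
  have hJ : MemLp (fun x : PhaseSpace (N + M) => junctionForce β hN hM x * x.2 ⟨N - 1, by omega⟩) 2
      (P.gibbsMeasure (N + M) T) := memLp_junctionForce_mul_momentum hω hl hβ γ hN hM hT
  have hkfL2 : MemLp kf 2 (P.gibbsMeasure (N + M) T) := ((hk0'.add hk1').const_mul γ).sub hJ
  -- the backward resolvent pair `(g₀ ∘ R, (p_0² − T) − κ g₀∘R)`
  set kh : PhaseSpace (N + M) → ℝ := fun x => (kin (N + M) 0 x - T) - κ * rev g₀ x with hkh
  have hpair_rev : ∀ x, -1 * liouvilleOp P (N + M) (rev g₀) x +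
      γ * bathOp (N + M) (deviceWeight N M) T (rev g₀) x = -kh x := fun x =>
    deviceResolvent_rev_pair ω₂ lam β γ T κ hpde₀ x
  have hrevC : ContDiff ℝ 2 (rev g₀) := contDiff_rev hg₀C
  have hrevL2 : MemLp (rev g₀) 2 (P.gibbsMeasure (N + M) T) := memLp_rev hω hl hβ (N + M) hT hg₀C.continuous hg₀L
  have hk0 : MemLp (fun x : PhaseSpace (N + M) => kin (N + M) 0 x - T) 2 (P.gibbsMeasure (N + M) T) :=
    memLp_kin_sub hω hl hβ γ (N + M) 0 hT
  have hkhL2 : MemLp kh 2 (P.gibbsMeasure (N + M) T) := hk0.sub (hrevL2.const_mul κ)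
  -- the cross Green identity
  have hcross := cross hω hl hβ (N + M) hT (deviceWeight N M) (deviceWeight_nonneg' N M) 1 hγ
    hfC hrevC hfL2 hrevL2 hkfL2 hkhL2 hpair_f hpair_rev
  -- `∫ (H_N∘π_N) (p_0² − T) ρ = T² ∫ ρ`
  have hdf : partialP ⟨0, by omega⟩ f = fun x : PhaseSpace (N + M) => x.2 ⟨0, by omega⟩ := by
    funext x
    have e := partialP_comp_restrictLeft_castAdd (M := M) (P.hamiltonian N) ⟨0, by omega⟩ x
    rw [P.partialP_hamiltonian, Fin.castAdd_mk] at e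
    exact e
  have hT2 : ∫ x, f x * (kin (N + M) 0 x - T) * ρ x = T ^ 2 * ∫ x, ρ x := by
    have h := gauss_ibp hω hl hβ (N + M) hT ⟨0, by omega⟩ (hfC.of_le (by norm_cast)) hfL2
      (by rw [hdf]; exact memLp_momentum hω hl hβ (N + M) hT ⟨0, by omega⟩)
    rw [hdf] at h
    have e1 : ∫ x, f x * (kin (N + M) 0 x - T) * ρ x = ∫ x, (x.2 ⟨0, by omega⟩ ^ 2 - T) * f x * ρ x :=
      integral_congr_ae (ae_of_all _ fun x => by
        dsimp only; rw [hρ, kin_eq_sq (show 0 < N + M by omega)]; ring)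
    have e2 : ∫ x, x.2 ⟨0, by omega⟩ * x.2 ⟨0, by omega⟩ * P.gibbsDensity (N + M) T x =
        ∫ x, x.2 ⟨0, by omega⟩ ^ 2 * P.gibbsDensity (N + M) T x :=
      integral_congr_ae (ae_of_all _ fun x => by ring)
    rw [e1, hρ, h, e2, integral_sq_mul_gibbsDensity_eq hω hl hβ (N + M) hT]
    ring
  -- the right-hand side `∫ f kh ρ = T² ∫ ρ − κ ∫ (g₀∘R) f ρ`
  have hIfk : Integrable fun x => f x * (kin (N + M) 0 x - T) * ρ x :=
    integrable_mul_mul_gibbsDensity hω hl hβ γ (N + M) hT hfL2 hk0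
  have hIfr : Integrable fun x => f x * rev g₀ x * ρ x :=
    integrable_mul_mul_gibbsDensity hω hl hβ γ (N + M) hT hfL2 hrevL2
  have eR : ∫ x, f x * kh x * ρ x = T ^ 2 * (∫ x, ρ x) - κ * ∫ x, rev g₀ x * f x * ρ x := by
    have e1 : ∫ x, f x * kh x * ρ x = (∫ x, f x * (kin (N + M) 0 x - T) * ρ x) - κ * ∫ x, f x * rev g₀ x * ρ x := by
      rw [← integral_const_mul, ← integral_sub hIfk (hIfr.const_mul κ)]
      exact integral_congr_ae (ae_of_all _ fun x => by simp only [hkh]; ring)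
    have e2 : ∫ x, f x * rev g₀ x * ρ x = ∫ x, rev g₀ x * f x * ρ x :=
      integral_congr_ae (ae_of_all _ fun x => by ring)
    rw [e1, hT2, e2]
  -- the left-hand side `∫ (g₀∘R) kf ρ = γ ∫ g₀ (k_0 + k_{N−1}) ρ − ∫ (g₀∘R) V' p_{N−1} ρ`
  have hIa : Integrable fun x => g₀ x * (x.2 ⟨0, by omega⟩ ^ 2 - T) * ρ x :=
    integrable_mul_mul_gibbsDensity hω hl hβ γ (N + M) hT hg₀L hk0'
  have hIb : Integrable fun x => g₀ x * (x.2 ⟨N - 1, by omega⟩ ^ 2 - T) * ρ x :=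
    integrable_mul_mul_gibbsDensity hω hl hβ γ (N + M) hT hg₀L hk1'
  have hIab : Integrable fun x => rev g₀ x * (γ * ((x.2 ⟨0, by omega⟩ ^ 2 - T) + (x.2 ⟨N - 1, by omega⟩ ^ 2 - T))) *
      ρ x :=
    integrable_mul_mul_gibbsDensity hω hl hβ γ (N + M) hT hrevL2 ((hk0'.add hk1').const_mul γ)
  have hIJ : Integrable fun x => rev g₀ x * (junctionForce β hN hM x * x.2 ⟨N - 1, by omega⟩) * ρ x :=
    integrable_mul_mul_gibbsDensity hω hl hβ γ (N + M) hT hrevL2 hJ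
  have hsplit : ∫ x, rev g₀ x * kf x * ρ x =
      (∫ x, rev g₀ x * (γ * ((x.2 ⟨0, by omega⟩ ^ 2 - T) + (x.2 ⟨N - 1, by omega⟩ ^ 2 - T))) * ρ x) -
        ∫ x, rev g₀ x * (junctionForce β hN hM x * x.2 ⟨N - 1, by omega⟩) * ρ x := by
    rw [← integral_sub hIab hIJ]
    refine integral_congr_ae (ae_of_all _ fun x => ?_)
    simp only [hkf]
    ring
  -- reversal invariance of the kinetic pairings
  have hreva : ∫ x, rev g₀ x * (γ * ((x.2 ⟨0, by omega⟩ ^ 2 - T) + (x.2 ⟨N - 1, by omega⟩ ^ 2 - T))) * ρ x =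
      γ * ((∫ x, g₀ x * (x.2 ⟨0, by omega⟩ ^ 2 - T) * ρ x) + ∫ x, g₀ x * (x.2 ⟨N - 1, by omega⟩ ^ 2 - T) * ρ x) := by
    have h := integral_rev_mul_gibbsDensity P T
      (fun x => g₀ x * (γ * ((x.2 ⟨0, by omega⟩ ^ 2 - T) + (x.2 ⟨N - 1, by omega⟩ ^ 2 - T))))
    have e1 : (fun x => rev (fun x => g₀ x * (γ * ((x.2 ⟨0, by omega⟩ ^ 2 - T) + (x.2 ⟨N - 1, by omega⟩ ^ 2 - T)))) x *
        P.gibbsDensity (N + M) T x) = fun x => rev g₀ x * (γ * ((x.2 ⟨0, by omega⟩ ^ 2 - T) +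
          (x.2 ⟨N - 1, by omega⟩ ^ 2 - T))) * ρ x := by
      funext x; simp only [rev_apply, Pi.neg_apply, neg_sq, hρ]
    rw [e1] at h
    rw [h, hρ, ← integral_add hIa hIb, ← integral_const_mul]
    exact integral_congr_ae (ae_of_all _ fun x => by ring)
  rw [hsplit, hreva, eR] at hcross
  have ef : ∫ x, rev g₀ x * f x * ρ x =
      ∫ x, rev g₀ x * (P.hamiltonian N (x.1 ∘ Fin.castAdd M, x.2 ∘ Fin.castAdd M)) * ρ x :=
    integral_congr_ae (ae_of_all _ fun x => rfl)
  rw [ef] at hcross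
  exact hcross


/-- **JUNCTION POWER PAIRING OF A RESOLVENT FIELD (fixed `N`, `M`, `κ`; exact).** For the pinned chain
(`ω₂ > 0`, `lam, β ≥ 0`, `γ, T > 0`, `N, M ≥ 1`) and a classical `κ`-resolvent field `g_0` of bath `0`:
`JP_N = ⟨g_0∘R, V'(r_J) p_{N−1}⟩ = γ(⟨g_0, p_0² − T⟩ + ⟨g_0, p²_{N−1} − T⟩) − T² + κ ⟨g_0∘R, H_N∘π_N⟩`
(all pairings in `L²(μ_T^{(N+M)})`; the last one is `terminationMass … g_0 H_N`). -/
theorem junctionPowerPairing_resolvent (hω : 0 < ω₂) (hl : 0 ≤ lam) (hβ : 0 ≤ β) (hγ : 0 < γ)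
    (hN : 1 ≤ N) (hM : 1 ≤ M) (hT : 0 < T) (κ : ℝ) {g₀ : PhaseSpace (N + M) → ℝ} (hg₀C : ContDiff ℝ 2 g₀)
    (hg₀L : MemLp g₀ 2 ((pinnedChain ω₂ lam β γ).gibbsMeasure (N + M) T))
    (hpde₀ : ∀ x, κ * g₀ x - deviceGenerator (pinnedChain ω₂ lam β γ) N M (fun _ => T) g₀ x =
      kin (N + M) 0 x - T) :
    ∫ x, g₀ (x.1, -x.2) * (junctionForce β hN hM x * x.2 ⟨N - 1, by omega⟩)
        ∂((pinnedChain ω₂ lam β γ).gibbsMeasure (N + M) T) =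
      γ * ((∫ x, g₀ x * (kin (N + M) 0 x - T) ∂((pinnedChain ω₂ lam β γ).gibbsMeasure (N + M) T)) +
          ∫ x, g₀ x * (kin (N + M) (N - 1) x - T) ∂((pinnedChain ω₂ lam β γ).gibbsMeasure (N + M) T)) - T ^ 2 +
        κ * terminationMass ω₂ lam β γ T N M g₀ ((pinnedChain ω₂ lam β γ).hamiltonian N) := by
  have hcross := junctionPowerPairing_resolvent_density hω hl hβ hγ hN hM hT κ hg₀C hg₀L hpde₀
  have hZ : 0 < ∫ x, (pinnedChain ω₂ lam β γ).gibbsDensity (N + M) T x := partition_pos hω hl hβ (N + M) hT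
  unfold terminationMass
  rw [(pinnedChain ω₂ lam β γ).integral_gibbsMeasure, (pinnedChain ω₂ lam β γ).integral_gibbsMeasure,
    (pinnedChain ω₂ lam β γ).integral_gibbsMeasure, (pinnedChain ω₂ lam β γ).integral_gibbsMeasure]
  have ea : ∫ x, g₀ x * (kin (N + M) 0 x - T) * (pinnedChain ω₂ lam β γ).gibbsDensity (N + M) T x =
      ∫ x, g₀ x * (x.2 ⟨0, by omega⟩ ^ 2 - T) * (pinnedChain ω₂ lam β γ).gibbsDensity (N + M) T x :=
    integral_congr_ae (ae_of_all _ fun x => by dsimp only; rw [kin_eq_sq (show 0 < N + M by omega)])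
  have eb : ∫ x, g₀ x * (kin (N + M) (N - 1) x - T) * (pinnedChain ω₂ lam β γ).gibbsDensity (N + M) T x =
      ∫ x, g₀ x * (x.2 ⟨N - 1, by omega⟩ ^ 2 - T) * (pinnedChain ω₂ lam β γ).gibbsDensity (N + M) T x :=
    integral_congr_ae (ae_of_all _ fun x => by dsimp only; rw [kin_eq_sq (show N - 1 < N + M by omega)])
  have eJ : ∫ x, g₀ (x.1, -x.2) * (junctionForce β hN hM x * x.2 ⟨N - 1, by omega⟩) *
      (pinnedChain ω₂ lam β γ).gibbsDensity (N + M) T x =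
      ∫ x, rev g₀ x * (junctionForce β hN hM x * x.2 ⟨N - 1, by omega⟩) *
        (pinnedChain ω₂ lam β γ).gibbsDensity (N + M) T x :=
    integral_congr_ae (ae_of_all _ fun x => rfl)
  have eH : ∫ x, g₀ (x.1, -x.2) * (pinnedChain ω₂ lam β γ).hamiltonian N (x.1 ∘ Fin.castAdd M, x.2 ∘ Fin.castAdd M) *
      (pinnedChain ω₂ lam β γ).gibbsDensity (N + M) T x =
      ∫ x, rev g₀ x * (pinnedChain ω₂ lam β γ).hamiltonian N (x.1 ∘ Fin.castAdd M, x.2 ∘ Fin.castAdd M) *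
        (pinnedChain ω₂ lam β γ).gibbsDensity (N + M) T x :=
    integral_congr_ae (ae_of_all _ fun x => rfl)
  rw [ea, eb, eJ, eH]
  have hinv : (∫ x, (pinnedChain ω₂ lam β γ).gibbsDensity (N + M) T x)⁻¹ *
      ∫ x, (pinnedChain ω₂ lam β γ).gibbsDensity (N + M) T x = 1 := inv_mul_cancel₀ hZ.ne'
  linear_combination -((∫ x, (pinnedChain ω₂ lam β γ).gibbsDensity (N + M) T x)⁻¹ * hcross) - T ^ 2 * hinv

/-- `K₀₁ = −(γ²/T²)⟨g_0, p²_{N−1} − T⟩` (unfolding the skeleton's `kuboMatrix` at `(0, 1)`; `termSite N M 1 = N − 1`). -/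
theorem kuboMatrix_zero_one_eq (ω₂ lam β γ T : ℝ) (N M : ℕ) (g : Fin 4 → PhaseSpace (N + M) → ℝ) :
    kuboMatrix ω₂ lam β γ T N M g 0 1 = -(γ ^ 2 / T ^ 2 *
      ∫ x, g 0 x * (kin (N + M) (N - 1) x - T) ∂((pinnedChain ω₂ lam β γ).gibbsMeasure (N + M) T)) := by
  simp [kuboMatrix, termSite_one]

/-- **THE RAYLEIGH TERM IN KUBO COORDINATES (fixed `N`, `M`, `κ`; exact).** For a family `g` whose bath-`0`
member is a `κ`-resolvent field of the `(N, M)`-device: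
`JP_N = −(T²/γ)(K₀₀(κ) + K₀₁(κ)) + κ ⟨g_0∘R, H_N∘π_N⟩` — the junction power pairing is MINUS `T²/γ` times the
sum of the self-coefficient and the transfer coefficient to the γ-probe at `N−1` (with vanishing row sums this is
`(T²/γ)(K₀₂ + K₀₃)`, i.e. `−T²/γ` times the conductance from bath `0` to the two terminals BEYOND the probe), up to
the `κ`-mass pairing with the left-block energy. -/
theorem junctionPowerPairing_eq_kubo (hω : 0 < ω₂) (hl : 0 ≤ lam) (hβ : 0 ≤ β) (hγ : 0 < γ) (hN : 1 ≤ N)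
    (hM : 1 ≤ M) (hT : 0 < T) (κ : ℝ) (g : Fin 4 → PhaseSpace (N + M) → ℝ)
    (hg₀ : g 0 ∈ deviceResolventFields ω₂ lam β γ T N M 0 κ) :
    ∫ x, g 0 (x.1, -x.2) * (junctionForce β hN hM x * x.2 ⟨N - 1, by omega⟩)
        ∂((pinnedChain ω₂ lam β γ).gibbsMeasure (N + M) T) =
      -(T ^ 2 / γ) * (kuboMatrix ω₂ lam β γ T N M g 0 0 + kuboMatrix ω₂ lam β γ T N M g 0 1) +
        κ * terminationMass ω₂ lam β γ T N M (g 0) ((pinnedChain ω₂ lam β γ).hamiltonian N) := by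
  obtain ⟨hg₀C, hg₀L, hpde₀⟩ := hg₀
  rw [junctionPowerPairing_resolvent hω hl hβ hγ hN hM hT κ hg₀C hg₀L hpde₀, kuboMatrix_zero_zero_eq,
    kuboMatrix_zero_one_eq]
  field_simp
  ring

end JunctionPower

/-! ## The row sum of bath `0` and the registered helper -/

section RowSum

variable {ω₂ lam β γ T : ℝ} {N M : ℕ}

/-- **Row sum of bath `0` of the resolvent Kubo matrix** (`N, M ≥ 2`, any `κ`):
`K₀₀ + K₀₁ + K₀₂ + K₀₃ = (γκ/T²) ⟨g_0, H_{N+M}⟩` — the `κ`-mass defect of the Onsager row sum (energy balance of the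
resolvent field against the total energy, `Kubo.resolvent_sum_kuboPair`). -/
theorem kuboMatrix_rowsum_zero (hω : 0 < ω₂) (hl : 0 ≤ lam) (hβ : 0 ≤ β) (hγ : 0 < γ) (hT : 0 < T) (hN : 2 ≤ N)
    (hM : 2 ≤ M) (κ : ℝ) {g : Fin 4 → PhaseSpace (N + M) → ℝ}
    (hg : ∀ a : Fin 4, g a ∈ deviceResolventFields ω₂ lam β γ T N M (termSite N M a) κ) :
    kuboMatrix ω₂ lam β γ T N M g 0 0 + kuboMatrix ω₂ lam β γ T N M g 0 1 + kuboMatrix ω₂ lam β γ T N M g 0 2 +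
        kuboMatrix ω₂ lam β γ T N M g 0 3 =
      γ * κ / T ^ 2 * ∫ x, g 0 x * (pinnedChain ω₂ lam β γ).hamiltonian (N + M) x
        ∂((pinnedChain ω₂ lam β γ).gibbsMeasure (N + M) T) := by
  have hN1 : 1 ≤ N := by omega
  have hM1 : 1 ≤ M := by omega
  set P := pinnedChain ω₂ lam β γ with hP
  set s := termFin N M hN1 hM1 with hs_def
  have hBw : deviceWeight N M = termWeight s := deviceWeight_eq_termWeight hN hM
  have hg2 : ∀ b, ContDiff ℝ 2 (g b) := fun b => (hg b).1
  have hgL : ∀ b, MemLp (g b) 2 (P.gibbsMeasure (N + M) T) := fun b => (hg b).2.1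
  have hkin : ∀ (b : Fin 4) (x : PhaseSpace (N + M)), kin (N + M) (termSite N M b) x = x.2 (s b) ^ 2 :=
    fun b x => kin_eq_sq (termSite_lt hN1 hM1 b) x
  have hpde : ∀ b x, (1 : ℝ) * liouvilleOp P (N + M) (g b) x +
      γ * bathOp (N + M) (termWeight s) T (g b) x = -((x.2 (s b) ^ 2 - T) - κ * g b x) := by
    intro b x
    have e := (hg b).2.2 x
    have hγP : (pinnedChain ω₂ lam β γ).γ = γ := rfl
    rw [hkin b x, deviceGenerator_eq, hBw, hγP] at e
    linarith
  have hsum := resolvent_sum_kuboPair hω hl hβ (N + M) hT s 1 hγ κ hg2 hgL hpde 0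
  rw [Fin.sum_univ_four] at hsum
  set Z := ∫ x, P.gibbsDensity (N + M) T x with hZ
  have hZpos : 0 < Z := partition_pos hω hl hβ (N + M) hT
  have hK : ∀ b, kuboMatrix ω₂ lam β γ T N M g 0 b = (if (0 : Fin 4) = b then γ else 0) -
      γ ^ 2 / T ^ 2 * (Z⁻¹ * ∫ x, g 0 x * (x.2 (s b) ^ 2 - T) * P.gibbsDensity (N + M) T x) := by
    intro b
    simp only [kuboMatrix, hkin b]
    rw [P.integral_gibbsMeasure]
  rw [hK 0, hK 1, hK 2, hK 3, P.integral_gibbsMeasure, ← hZ]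
  simp only [if_true, Fin.isValue, show (0 : Fin 4) ≠ 1 by decide, show (0 : Fin 4) ≠ 2 by decide,
    show (0 : Fin 4) ≠ 3 by decide, if_false]
  have hγ0 : γ ≠ 0 := hγ.ne'
  have hT0 : T ≠ 0 := hT.ne'
  have hZ0 : Z ≠ 0 := hZpos.ne'
  set A0 := ∫ x, g 0 x * (x.2 (s 0) ^ 2 - T) * P.gibbsDensity (N + M) T x with hA0
  set A1 := ∫ x, g 0 x * (x.2 (s 1) ^ 2 - T) * P.gibbsDensity (N + M) T x with hA1
  set A2 := ∫ x, g 0 x * (x.2 (s 2) ^ 2 - T) * P.gibbsDensity (N + M) T x with hA2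
  set A3 := ∫ x, g 0 x * (x.2 (s 3) ^ 2 - T) * P.gibbsDensity (N + M) T x with hA3
  set IH := ∫ x, g 0 x * P.hamiltonian (N + M) x * P.gibbsDensity (N + M) T x with hIH
  have e1 : γ - γ ^ 2 / T ^ 2 * (Z⁻¹ * A0) + (0 - γ ^ 2 / T ^ 2 * (Z⁻¹ * A1)) + (0 - γ ^ 2 / T ^ 2 * (Z⁻¹ * A2)) +
      (0 - γ ^ 2 / T ^ 2 * (Z⁻¹ * A3)) = γ - γ ^ 2 / T ^ 2 * Z⁻¹ * (A0 + A1 + A2 + A3) := by ring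
  rw [e1, hsum]
  field_simp
  ring

/-- **Registered helper `helper_terminationJunctionPowerResolvent` — THE JUNCTION POWER PAIRING OF A RESOLVENT FAMILY
IN KUBO COORDINATES (fixed `N, M ≥ 2`, any `κ`; exact).** For every resolvent family `g` of the `(N, M)`-device:
`⟨g_0∘R, V'(q_N − q_{N−1}) p_{N−1}⟩ = (T²/γ)(K₀₂ + K₀₃) − κ ⟨g_0∘R, H_{N+M} − H_N∘π_N⟩` — `junctionPowerPairing_eq_kubo`
combined with the row sum `kuboMatrix_rowsum_zero` (reversal invariance of `μ_T` moves the `κ`-mass onto `g_0∘R`). With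
non-negative transfers (`K₀₂, K₀₃ ≤ 0`) the pairing is `≤ 0` up to the `κ`-term, i.e. `−(γ²/T²)(G_N/γ²)·JP_N ≥ 0`: the
Rayleigh part RAISES `K₀₀` above `G_N`. -/
theorem helper_terminationJunctionPowerResolvent : ∀ (ω₂ lam β γ T : ℝ), 0 < ω₂ → 0 ≤ lam → 0 ≤ β → 0 < γ → 0 < T → ∀ (N M : ℕ) (hN : 2 ≤ N) (hM : 2 ≤ M) (κ : ℝ) (g : Fin 4 → PhaseSpace (N + M) → ℝ), (∀ a : Fin 4, g a ∈ deviceResolventFields ω₂ lam β γ T N M (termSite N M a) κ) → ∫ x, g 0 (x.1, -x.2) * (((x.1 ⟨N, by omega⟩ - x.1 ⟨N - 1, by omega⟩) + β * (x.1 ⟨N, by omega⟩ - x.1 ⟨N - 1, by omega⟩) ^ 3) * x.2 ⟨N - 1, by omega⟩) ∂((pinnedChain ω₂ lam β γ).gibbsMeasure (N + M) T) = T ^ 2 / γ * (kuboMatrix ω₂ lam β γ T N M g 0 2 + kuboMatrix ω₂ lam β γ T N M g 0 3) - κ * ∫ x, ((pinnedChain ω₂ lam β γ).hamiltonian (N +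 M) x - (pinnedChain ω₂ lam β γ).hamiltonian N (x.1 ∘ Fin.castAdd M, x.2 ∘ Fin.castAdd M)) * g 0 (x.1, -x.2) ∂((pinnedChain ω₂ lam β γ).gibbsMeasure (N + M) T) := by
  intro ω₂ lam β γ T hω hl hβ hγ hT N M hN hM κ g hg
  have hN1 : 1 ≤ N := by omega
  have hM1 : 1 ≤ M := by omega
  set P := pinnedChain ω₂ lam β γ with hP
  set μ := P.gibbsMeasure (N + M) T with hμ
  have hJP : ∫ x, g 0 (x.1, -x.2) * (((x.1 ⟨N, by omega⟩ - x.1 ⟨N - 1, by omega⟩) +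
      β * (x.1 ⟨N, by omega⟩ - x.1 ⟨N - 1, by omega⟩) ^ 3) * x.2 ⟨N - 1, by omega⟩) ∂μ =
      -(T ^ 2 / γ) * (kuboMatrix ω₂ lam β γ T N M g 0 0 + kuboMatrix ω₂ lam β γ T N M g 0 1) +
        κ * terminationMass ω₂ lam β γ T N M (g 0) (P.hamiltonian N) :=
    junctionPowerPairing_eq_kubo hω hl hβ hγ hN1 hM1 hT κ g (hg 0)
  have hRS := kuboMatrix_rowsum_zero hω hl hβ hγ hT hN hM κ hg
  -- reversal invariance: `⟨g_0, H⟩ = ⟨H, g_0∘R⟩`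
  have hrev : ∫ x, g 0 x * P.hamiltonian (N + M) x ∂μ = ∫ x, P.hamiltonian (N + M) x * g 0 (x.1, -x.2) ∂μ := by
    rw [hμ, P.integral_gibbsMeasure, P.integral_gibbsMeasure]
    congr 1
    have h := integral_rev_mul_gibbsDensity P T (fun x => g 0 x * P.hamiltonian (N + M) x)
    rw [← h]
    exact integral_congr_ae (ae_of_all _ fun x => by
      simp only [rev_apply, OscillatorChain.hamiltonian_neg_momentum]; ring)
  -- splitting the `κ`-pairing
  obtain ⟨hg₀C, hg₀L, -⟩ := hg 0
  have hrevL : MemLp (rev (g 0)) 2 μ := memLp_rev hω hl hβ (N + M) hT hg₀C.continuous hg₀L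
  have hHL : MemLp (P.hamiltonian (N + M)) 2 μ := memLp_hamiltonian hω hl hβ (N + M) hT
  have hHNL : MemLp (fun x : PhaseSpace (N + M) => P.hamiltonian N (x.1 ∘ Fin.castAdd M, x.2 ∘ Fin.castAdd M)) 2 μ :=
    memLp_comp_restrictLeft hω hl hβ γ hN1 hM1 hT (memLp_hamiltonian hω hl hβ N hT)
  have hI1 : Integrable (fun x : PhaseSpace (N + M) => P.hamiltonian (N + M) x * g 0 (x.1, -x.2)) μ :=
    hHL.integrable_mul hrevL
  have hI2 : Integrable (fun x : PhaseSpace (N + M) =>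
      P.hamiltonian N (x.1 ∘ Fin.castAdd M, x.2 ∘ Fin.castAdd M) * g 0 (x.1, -x.2)) μ := hHNL.integrable_mul hrevL
  have hsplit : ∫ x, (P.hamiltonian (N + M) x - P.hamiltonian N (x.1 ∘ Fin.castAdd M, x.2 ∘ Fin.castAdd M)) *
      g 0 (x.1, -x.2) ∂μ = (∫ x, P.hamiltonian (N + M) x * g 0 (x.1, -x.2) ∂μ) -
        terminationMass ω₂ lam β γ T N M (g 0) (P.hamiltonian N) := by
    unfold terminationMass
    have e : ∫ x, g 0 (x.1, -x.2) * P.hamiltonian N (x.1 ∘ Fin.castAdd M, x.2 ∘ Fin.castAdd M) ∂μ =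
        ∫ x, P.hamiltonian N (x.1 ∘ Fin.castAdd M, x.2 ∘ Fin.castAdd M) * g 0 (x.1, -x.2) ∂μ :=
      integral_congr_ae (ae_of_all _ fun x => by ring)
    rw [hP] at e ⊢
    rw [e, ← integral_sub hI1 hI2]
    exact integral_congr_ae (ae_of_all _ fun x => by ring)
  rw [hJP, hsplit, ← hrev]
  have hγ0 : γ ≠ 0 := hγ.ne'
  have hT0 : T ≠ 0 := hT.ne'
  have key : -(T ^ 2 / γ) * (kuboMatrix ω₂ lam β γ T N M g 0 0 + kuboMatrix ω₂ lam β γ T N M g 0 1) =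
      T ^ 2 / γ * (kuboMatrix ω₂ lam β γ T N M g 0 2 + kuboMatrix ω₂ lam β γ T N M g 0 3) -
        κ * ∫ x, g 0 x * P.hamiltonian (N + M) x ∂μ := by
    have e : kuboMatrix ω₂ lam β γ T N M g 0 0 + kuboMatrix ω₂ lam β γ T N M g 0 1 =
        γ * κ / T ^ 2 * (∫ x, g 0 x * P.hamiltonian (N + M) x ∂μ) -
          (kuboMatrix ω₂ lam β γ T N M g 0 2 + kuboMatrix ω₂ lam β γ T N M g 0 3) := by
      rw [← hRS]; ring
    rw [e]
    field_simp
    ring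
  rw [key]
  ring

end RowSum

end Summit.AtomisticToContinuum.FouriersLaw.Cruxes.SuperadditiveResistance.FloatingProbeBypassLaplacian

end
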